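import Summits.CriticalPhenomena.PercolationContinuityZ3.Theorems.SahiTP2CellFKG

/-!
# Cell-FKG ⟺ TP₂ of all rectangle masses: the intrinsic form of the "cell-FKG" hypothesis

Companion of `SahiTP2CellFKG.lean` (cell `prim-sahi`, typer seat, generation 10; `--supports stmt-CriticalPhenomena-4575`).

Generation 6 (`SahiTwoDimSemicontinuous`) introduced "cell-FKG" measures on `[0,1]²` — the cell weights of every
`(m+1) × (m+1)` grid satisfy the FKG lattice condition — and the paper recorded that the notion was "not known to
coincide with an intrinsic FKG property of singular measures".  It does:

* `IsRectTP2 μ` — TP₂ of the RECTANGLE masses: `μ(I₁ × J₂) μ(I₂ × J₁) ≤ μ(I₁ × J₁) μ(I₂ × J₂)` for order-connected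
  measurable `I₁ < I₂` (first coordinate) and `J₁ < J₂` (second coordinate), `<` elementwise;
* `isFKGMeasure_cellWeight_iff_isRectTP2` — for a probability measure on `[0,1]²`: cell-FKG on every grid ⟺
  `IsRectTP2` (⇐: cells are products of order-connected fibres of the cell index; ⇒: every order-connected subset of
  `[0,1]` is cut out by its infimum/supremum with an open or closed end on each side, hence is the pointwise limit of
  blocks of cells chosen from OUTSIDE at closed ends and from INSIDE at open ends, and the level-`m` inequality of
  `SahiTP2CellFKG` passes to the limit);
* `IsRectTP2.isTP2Cut` — rectangle-TP₂ implies TP₂ across cuts (the case `J₁ = L`, `J₂ = Lᶜ`); the converse fails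
  (`SahiTP2Kernel`, doc of `IsTP2Cut`).

So the two-dimensional picture of generation 10 reads: cell-FKG ⟺ rectangle-TP₂ ⟹ cut-TP₂ ⟺ conditionally increasing
⟹ Sahi-positive of every order.  No sorries, no new axioms.
-/

noncomputable section

namespace Summit.CriticalPhenomena.PercolationContinuityZ3.Theorems.SahiTP2

open MeasureTheory Set Filter Topology Function
open Literature.Combinatorics.Sahi2008 Literature.Combinatorics.Sahi2008.LebesgueSquare SahiTwoDimDensity
open scoped ENNReal unitInterval

/-! ## Rectangle TP₂ -/

/-- **TP₂ of the rectangle masses**: for order-connected measurable `I₁ < I₂` and `J₁ < J₂` (elementwise `<`),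
`μ(I₁ × J₂) μ(I₂ × J₁) ≤ μ(I₁ × J₁) μ(I₂ × J₂)`. [this work] -/
def IsRectTP2 {α β : Type*} [Preorder α] [Preorder β] [MeasurableSpace α] [MeasurableSpace β]
    (μ : Measure (α × β)) : Prop :=
  ∀ ⦃I₁ I₂ : Set α⦄ ⦃J₁ J₂ : Set β⦄, I₁.OrdConnected → I₂.OrdConnected → J₁.OrdConnected → J₂.OrdConnected →
    MeasurableSet I₁ → MeasurableSet I₂ → MeasurableSet J₁ → MeasurableSet J₂ →
    (∀ x ∈ I₁, ∀ x' ∈ I₂, x < x') → (∀ y ∈ J₁, ∀ y' ∈ J₂, y < y') →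
    μ (I₁ ×ˢ J₂) * μ (I₂ ×ˢ J₁) ≤ μ (I₁ ×ˢ J₁) * μ (I₂ ×ˢ J₂)

/-- **Rectangle-TP₂ implies TP₂ across cuts** (`J₁ = L`, `J₂ = Lᶜ`). [this work] -/
theorem IsRectTP2.isTP2Cut {α β : Type*} [Preorder α] [TopologicalSpace α] [OrderClosedTopology α]
    [MeasurableSpace α] [OpensMeasurableSpace α] [LinearOrder β] [MeasurableSpace β] {μ : Measure (α × β)}
    (h : IsRectTP2 μ) : IsTP2Cut μ := by
  intro a₁ b₁ a₂ b₂ hlt L hL hLm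
  exact h ordConnected_Icc ordConnected_Icc hL.ordConnected hL.compl.ordConnected measurableSet_Icc measurableSet_Icc
    hLm hLm.compl (fun x hx x' hx' => lt_of_le_of_lt hx.2 (hlt.trans_le hx'.1))
    fun y hy y' hy' => lt_of_not_ge fun hle => hy' (hL hle hy)

/-! ## Rectangle-TP₂ ⟹ cell-FKG -/

variable {m : ℕ}

/-- The fibres of the cell index are order-connected. [folklore] -/
theorem ordConnected_cellIdx_fibre (i : Fin (m + 1)) : ((cellIdx m ⁻¹' {i} : Set I)).OrdConnected := by
  refine ⟨fun x hx x' hx' z hz => ?_⟩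
  simp only [mem_preimage, mem_singleton_iff] at hx hx' ⊢
  exact le_antisymm (hx' ▸ cellIdx_le_cellIdx hz.2) (hx ▸ cellIdx_le_cellIdx hz.1)

/-- Distinct fibres of the cell index are strictly ordered. [folklore] -/
theorem cellIdx_fibre_lt {i i' : Fin (m + 1)} (hii' : i < i') :
    ∀ x ∈ (cellIdx m ⁻¹' {i} : Set I), ∀ x' ∈ (cellIdx m ⁻¹' {i'} : Set I), x < x' := by
  intro x hx x' hx'
  simp only [mem_preimage, mem_singleton_iff] at hx hx'
  by_contra h
  exact absurd (hx ▸ hx' ▸ cellIdx_le_cellIdx (not_lt.1 h) : i' ≤ i) (not_le.2 hii')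

/-- A cell is the product of two fibres of the cell index. [folklore] -/
theorem cellPair_preimage_singleton (c : Fin (m + 1) × Fin (m + 1)) :
    (cellPair m ⁻¹' {c} : Set (I × I)) = (cellIdx m ⁻¹' {c.1}) ×ˢ (cellIdx m ⁻¹' {c.2}) := by
  ext p
  simp only [mem_preimage, mem_singleton_iff, mem_prod, Prod.ext_iff]
  rfl

/-- **TP₂ of the rectangle masses implies the FKG lattice condition for the cell weights of every grid.**
[this work] -/
theorem isFKGMeasure_cellWeight_of_isRectTP2 (μ : Measure (I × I)) [IsProbabilityMeasure μ] (h : IsRectTP2 μ)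
    (m : ℕ) : IsFKGMeasure (cellWeight μ m) where
  nonneg := cellWeight_nonneg μ
  sum_eq_one := sum_cellWeight μ
  mul_le_mul := by
    -- the lattice condition for two incomparable cells is one rectangle inequality
    have key : ∀ c d : Fin (m + 1) × Fin (m + 1), c.1 < d.1 → d.2 < c.2 →
        cellWeight μ m c * cellWeight μ m d ≤ cellWeight μ m (c ⊓ d) * cellWeight μ m (c ⊔ d) := by
      intro c d h1 h2
      have hinf : c ⊓ d = (c.1, d.2) := Prod.ext (inf_of_le_left h1.le) (inf_of_le_right h2.le)
      have hsup : c ⊔ d = (d.1, c.2) := Prod.ext (sup_of_le_right h1.le) (sup_of_le_left h2.le)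
      have hI := h (ordConnected_cellIdx_fibre c.1) (ordConnected_cellIdx_fibre d.1) (ordConnected_cellIdx_fibre d.2)
        (ordConnected_cellIdx_fibre c.2) (ordConnected_cellIdx_fibre c.1).measurableSet
        (ordConnected_cellIdx_fibre d.1).measurableSet (ordConnected_cellIdx_fibre d.2).measurableSet
        (ordConnected_cellIdx_fibre c.2).measurableSet (cellIdx_fibre_lt h1) (cellIdx_fibre_lt h2)
      simp only [cellWeight, measureReal_def, cellPair_preimage_singleton, hinf, hsup]
      rw [← ENNReal.toReal_mul, ← ENNReal.toReal_mul]
      exact ENNReal.toReal_mono (ENNReal.mul_ne_top (measure_ne_top _ _) (measure_ne_top _ _)) hI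
    intro c d
    rcases lt_trichotomy c.1 d.1 with h1 | h1 | h1
    · rcases lt_or_ge d.2 c.2 with h2 | h2
      · exact key c d h1 h2
      · have hcd : c ≤ d := ⟨h1.le, h2⟩
        rw [inf_of_le_left hcd, sup_of_le_right hcd]
    · rcases le_total c.2 d.2 with h2 | h2
      · have hcd : c ≤ d := ⟨h1.le, h2⟩
        rw [inf_of_le_left hcd, sup_of_le_right hcd]
      · have hdc : d ≤ c := ⟨h1.ge, h2⟩
        rw [inf_of_le_right hdc, sup_of_le_left hdc, mul_comm]
    · rcases lt_or_ge c.2 d.2 with h2 | h2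
      · rw [mul_comm, inf_comm, sup_comm]
        exact key d c h1 h2
      · have hdc : d ≤ c := ⟨h1.le, h2⟩
        rw [inf_of_le_right hdc, sup_of_le_left hdc, mul_comm]

/-! ## Cell-FKG ⟹ rectangle-TP₂ -/

/-- **Order-connected subsets of a complete linear order are cut out by their infimum and supremum**, each end open
or closed. [folklore] -/
theorem OrdConnected.exists_endpoints {α : Type*} [CompleteLinearOrder α] {C : Set α} (hC : C.OrdConnected) :
    ∃ (lc uc : Prop), C = {y | ((lc ∧ sInf C ≤ y) ∨ (¬ lc ∧ sInf C < y)) ∧ ((uc ∧ y ≤ sSup C) ∨ (¬ uc ∧ y < sSup C))} := by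
  refine ⟨sInf C ∈ C, sSup C ∈ C, Subset.antisymm (fun y hy => ?_) fun y hy => ?_⟩
  · refine ⟨?_, ?_⟩
    · by_cases h : sInf C ∈ C
      · exact Or.inl ⟨h, sInf_le hy⟩
      · exact Or.inr ⟨h, lt_of_le_of_ne (sInf_le hy) fun heq => h (heq ▸ hy)⟩
    · by_cases h : sSup C ∈ C
      · exact Or.inl ⟨h, le_sSup hy⟩
      · exact Or.inr ⟨h, lt_of_le_of_ne (le_sSup hy) fun heq => h (heq ▸ hy)⟩
  · obtain ⟨hlo, hhi⟩ := hy
    -- a point of `C` below `y` and one above `y`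
    obtain ⟨c, hc, hcy⟩ : ∃ c ∈ C, c ≤ y := by
      rcases hlo with ⟨hmem, hle⟩ | ⟨_, hlt⟩
      · exact ⟨_, hmem, hle⟩
      · obtain ⟨c, hc, hcy⟩ := sInf_lt_iff.1 hlt
        exact ⟨c, hc, hcy.le⟩
    obtain ⟨c', hc', hyc'⟩ : ∃ c' ∈ C, y ≤ c' := by
      rcases hhi with ⟨hmem, hle⟩ | ⟨_, hlt⟩
      · exact ⟨_, hmem, hle⟩
      · obtain ⟨c', hc', hyc'⟩ := lt_sSup_iff.1 hlt
        exact ⟨c', hc', hyc'.le⟩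
    exact hC.out hc hc' ⟨hcy, hyc'⟩

/-- **Convergence of cell blocks picked out pointwise**: if `cellIdx m x ∈ J m ↔ x ∈ S` and `cellIdx m y ∈ K m ↔ y ∈ T`
eventually, for every point, then `μ(block J m × K m) → μ(S × T)`. [this work] -/
theorem tendsto_measure_block (μ : Measure (I × I)) [IsFiniteMeasure μ] (J K : ∀ m : ℕ, Finset (Fin (m + 1)))
    {S T : Set I} (hJS : ∀ x : I, ∀ᶠ m : ℕ in atTop, (cellIdx m x ∈ J m ↔ x ∈ S))
    (hKT : ∀ y : I, ∀ᶠ m : ℕ in atTop, (cellIdx m y ∈ K m ↔ y ∈ T)) :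
    Tendsto (fun m : ℕ => μ (cellPair m ⁻¹' ↑(J m ×ˢ K m))) atTop (𝓝 (μ (S ×ˢ T))) := by
  refine tendsto_measure_of_tendsto_indicator atTop (fun m => measurableSet_cellBlock _ _) MeasurableSet.univ
    (measure_ne_top μ _) (Eventually.of_forall fun m => subset_univ _) fun p => ?_
  filter_upwards [hJS p.1, hKT p.2] with m h1 h2
  rw [mem_cellBlock, mem_prod, h1, h2]

/-- The index block of an endpoint-described interval at grid level `m` (closed ends from outside, open ends from
inside), and its pointwise convergence. [this work] -/
theorem exists_block_of_endpoints (c₀ c₁ : I) (lc uc : Prop) :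
    ∃ K : ∀ m : ℕ, Finset (Fin (m + 1)),
      (∀ m k, k ∈ K m ↔ ((lc ∧ cellIdx m c₀ ≤ k) ∨ (¬ lc ∧ cellIdx m c₀ < k)) ∧
        ((uc ∧ k ≤ cellIdx m c₁) ∨ (¬ uc ∧ k < cellIdx m c₁))) ∧
      ∀ y : I, ∀ᶠ m : ℕ in atTop, (cellIdx m y ∈ K m ↔
        y ∈ {y | ((lc ∧ c₀ ≤ y) ∨ (¬ lc ∧ c₀ < y)) ∧ ((uc ∧ y ≤ c₁) ∨ (¬ uc ∧ y < c₁))}) := by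
  classical
  refine ⟨fun m => Finset.univ.filter fun k => ((lc ∧ cellIdx m c₀ ≤ k) ∨ (¬ lc ∧ cellIdx m c₀ < k)) ∧
      ((uc ∧ k ≤ cellIdx m c₁) ∨ (¬ uc ∧ k < cellIdx m c₁)), fun m k => by simp, fun y => ?_⟩
  filter_upwards [eventually_cellIdx_le_iff c₀ y, eventually_cellIdx_lt_iff c₀ y, eventually_cellIdx_le_iff y c₁,
    eventually_cellIdx_lt_iff y c₁] with m h1 h2 h3 h4
  simp only [Finset.mem_filter, Finset.mem_univ, true_and]
  rw [h1, h2, h3, h4]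

/-- Suprema of a set lying elementwise below another set are below its infimum (plumbing). [folklore] -/
theorem sSup_le_sInf_of_forall_lt {α : Type*} [CompleteLinearOrder α] {A B : Set α} (h : ∀ x ∈ A, ∀ x' ∈ B, x < x') :
    sSup A ≤ sInf B :=
  sSup_le fun x hx => le_sInf fun x' hx' => (h x hx x' hx').le

/-- **Cell-FKG implies TP₂ of the rectangle masses.** [this work] -/
theorem isRectTP2_of_isFKGMeasure_cellWeight (μ : Measure (I × I)) [IsFiniteMeasure μ]
    (hFKG : ∀ m, IsFKGMeasure (cellWeight μ m)) : IsRectTP2 μ := by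
  intro I₁ I₂ J₁ J₂ hI₁ hI₂ hJ₁ hJ₂ _ _ _ _ hII hJJ
  obtain ⟨la, ua, hI₁eq⟩ := OrdConnected.exists_endpoints hI₁
  obtain ⟨lb, ub, hI₂eq⟩ := OrdConnected.exists_endpoints hI₂
  obtain ⟨lc, uc, hJ₁eq⟩ := OrdConnected.exists_endpoints hJ₁
  obtain ⟨ld, ud, hJ₂eq⟩ := OrdConnected.exists_endpoints hJ₂
  obtain ⟨JA, hJA, hJAp⟩ := exists_block_of_endpoints (sInf I₁) (sSup I₁) la ua
  obtain ⟨JB, hJB, hJBp⟩ := exists_block_of_endpoints (sInf I₂) (sSup I₂) lb ub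
  obtain ⟨KC, hKC, hKCp⟩ := exists_block_of_endpoints (sInf J₁) (sSup J₁) lc uc
  obtain ⟨KD, hKD, hKDp⟩ := exists_block_of_endpoints (sInf J₂) (sSup J₂) ld ud
  rw [← hI₁eq] at hJAp
  rw [← hI₂eq] at hJBp
  rw [← hJ₁eq] at hKCp
  rw [← hJ₂eq] at hKDp
  have t12 := tendsto_measure_block μ JA KD hJAp hKDp
  have t21 := tendsto_measure_block μ JB KC hJBp hKCp
  have t11 := tendsto_measure_block μ JA KC hJAp hKCp
  have t22 := tendsto_measure_block μ JB KD hJBp hKDp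
  refine le_of_tendsto_of_tendsto'
    (ENNReal.Tendsto.mul t12 (Or.inr (measure_ne_top _ _)) t21 (Or.inr (measure_ne_top _ _)))
    (ENNReal.Tendsto.mul t11 (Or.inr (measure_ne_top _ _)) t22 (Or.inr (measure_ne_top _ _))) fun m => ?_
  have hA : cellIdx m (sSup I₁) ≤ cellIdx m (sInf I₂) := cellIdx_le_cellIdx (sSup_le_sInf_of_forall_lt hII)
  have hC : cellIdx m (sSup J₁) ≤ cellIdx m (sInf J₂) := cellIdx_le_cellIdx (sSup_le_sInf_of_forall_lt hJJ)
  refine measure_cellBlock_mul_le μ (hFKG m) (JA m) (JB m) (KC m) (KD m) (fun i hi i' hi' => ?_)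
    fun j hj j' hj' => ?_
  · have hi1 : i ≤ cellIdx m (sSup I₁) := by
      rcases ((hJA m i).1 hi).2 with ⟨_, h⟩ | ⟨_, h⟩
      · exact h
      · exact h.le
    have hi2 : cellIdx m (sInf I₂) ≤ i' := by
      rcases ((hJB m i').1 hi').1 with ⟨_, h⟩ | ⟨_, h⟩
      · exact h
      · exact h.le
    exact hi1.trans (hA.trans hi2)
  · have hj1 : j ≤ cellIdx m (sSup J₁) := by
      rcases ((hKC m j).1 hj).2 with ⟨_, h⟩ | ⟨_, h⟩
      · exact h
      · exact h.le
    have hj2 : cellIdx m (sInf J₂) ≤ j' := by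
      rcases ((hKD m j').1 hj').1 with ⟨_, h⟩ | ⟨_, h⟩
      · exact h
      · exact h.le
    exact hj1.trans (hC.trans hj2)

/-- **Cell-FKG on every grid ⟺ TP₂ of the rectangle masses** (probability measures on the unit square): the
intrinsic form of the cell-FKG hypothesis of `SahiTwoDimSemicontinuous`. [this work] -/
theorem isFKGMeasure_cellWeight_iff_isRectTP2 (μ : Measure (I × I)) [IsProbabilityMeasure μ] :
    (∀ m, IsFKGMeasure (cellWeight μ m)) ↔ IsRectTP2 μ :=
  ⟨isRectTP2_of_isFKGMeasure_cellWeight μ, isFKGMeasure_cellWeight_of_isRectTP2 μ⟩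

end Summit.CriticalPhenomena.PercolationContinuityZ3.Theorems.SahiTP2
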